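import Literature.ModelTheory.ExponentialFields.Wilkie1996DclValRank
import Literature.ModelTheory.ExponentialFields.ERestricted
import HarnessLib

/-!
# Wilkie 1996, §§10–11 / den Besten, Lemma 7.1.19 and Theorem 7.1.23: the valuation-rank bound is a one-step statement

Topic `Literature/ModelTheory/ExponentialFields`.  `Wilkie1996DclValRank.lean` reduces the
boundedness leaf `Wilkie1996_expPolynomialPoints_bounded` of Wilkie's theorem (hence
`wilkie_isModelComplete`, `Wilkie1996_expPolynomial_transfer`, …) to the single hypothesis

> `hV`: for all models `k ⊆ K` of `T_exp` (embedding `f`) and every finite `B ⊆ K`, the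
> valuative rank of `Dcl_e(f(k) ∪ B)` over `f(k)` is at most `|B|`: any `|B| + 1` non-zero
> elements of `Dcl_e(f(k) ∪ B)` are multiplicatively dependent over `ℤ` modulo `f(k)^×` and the
> units of the valuation ring `Fin(K)` of `K`,

the instance of the valuation inequality `valdim_k(K') ≤ dim_k(K')` (M. den Besten, *Wilkie's
Theorem and the Uniform Real Schanuel Conjecture*, MSc thesis, Utrecht 2016, Theorem 7.1.23;
A. J. Wilkie, J. Amer. Math. Soc. 9 (1996), §10) for `k' = f(k) ⊆ K' = Dcl_e(k' ∪ B)`,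
`dim_{k'} K' ≤ |B|`.  The printed proof of Theorem 7.1.23 begins (p. 89): "*Since `dim_k(K)` is
finite, there exist `k = k₀ ≼ k₁ ≼ ⋯ ≼ kₙ = K`, such that `dim_{kᵢ}(k_{i+1}) = 1` for each `i` …
by Lemma 7.1.13 and Lemma 7.1.19, it is enough to prove the inequality asserted in the Theorem
just for the case `dim_k(K) = 1`*", Lemma 7.1.19 being the additivity of `valdim` in towers
`k₀ ⊆ k₁ ⊆ K` (p. 82: "*given three `ℚ`-vector spaces `V₀ ⊆ V₁ ⊆ V₂`, we have `d₀ = d₁ + d₂`*").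
**This file proves that reduction in the tree's vocabulary** (`RealExpModel.IsVUnit`,
`Wilkie1996Lemma93Valuation.lean`; valuative rank `≤ r` of `S` over a subgroup `H ⊇ units` of
`K^×` meaning: any `r + 1` non-zero elements of `S` satisfy `Π xⱼ^{eⱼ} ∈ H` for some
`e ∈ ℤ^{r+1} ∖ {0}`), so that what remains of `hV` is the case `dim = 1` alone:

> `h1` (**one-step valuation inequality for `T_e`**): for every `K ⊨ T_exp`, every `A ⊆ K` and
> `b ∈ K`, any two non-zero elements `x, y ∈ Dcl_e(A ∪ {b})` satisfy
> `a · x^{e₀} · y^{e₁} ∈ Fin(K)^×` for some `(e₀, e₁) ∈ ℤ² ∖ {0}` and some non-zero `a ∈ Dcl_e(A)`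
> (the valuative rank of `Dcl_e(A ∪ {b})` over `Dcl_e(A)` is at most `1` — Theorem 7.1.23 for
> `k = Dcl_e(A) ≼ Dcl_e(A ∪ {b}) = Dcl_k(b)`, `dim_k ≤ 1`),

together with the First Main Theorem for `exp↾[0,1]` in the form used throughout this topic,
`hMC : rexpTheory.IsModelComplete` (`RestrictedExp.lean`), through which `f(k) ≼ K | L_e`
(`RealExpModel.eElementaryEmbeddingOfRexp`, `ERestricted.lean`; den Besten, Corollary 6.2.4) and
hence `Dcl_e(f(k)) = f(k)` (the base of the induction on `B`).

* `definableClosure_range_subset_of_elementaryEmbedding` — the image of an elementary embedding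
  is definably closed (`dcl(g(M)) = g(M)`; general first-order lemma);
* `ValRankTower.exists_ne_zero_of_rank_conditions` — the combinatorial core of Lemma 7.1.19 for
  integer exponent vectors: if every `r₂ + 1` coordinates support a non-zero vector of a family
  `P₂ ⊆ ℤ^ι` and any `r₁ + 1` vectors of `P₂` have a non-trivial `ℤ`-combination in `P₁`, and
  `|ι| > r₁ + r₂`, then `P₁` has a non-zero vector (maximal `P₂`-independent set of coordinates);
* `ValRankTower.exists_zpow_rel_of_tower` — **Lemma 7.1.19 (the inequality
  `valdim_{H}(S) ≤ valdim_{H}(A) + valdim_{A·H}(S)`) in multiplicative form**: in a field, for a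
  subgroup-like predicate `H` (contains `1`, closed under `·` and `⁻¹`) and any predicate `A`, if
  any `r₁ + 1` non-zero elements of `A` have a relation in `H` and any `r₂ + 1` of the non-zero
  elements `x₀, …, x_{r₁+r₂}` have a relation in `A^× · H`, then `x₀, …, x_{r₁+r₂}` have a
  relation in `H`;
* `RealExpModel.dclValRank_of_oneStep` — **`hV` from `hMC` and `h1`** (induction on `B`:
  Theorem 7.1.23, first paragraph of the proof, with Lemma 7.1.13 replaced by the trivial count
  `Dcl_e(f(k) ∪ B ∪ {b}) = Dcl_e((f(k) ∪ B) ∪ {b})`);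
* `Wilkie1996_expPolynomialPoints_bounded_of_oneStep`, `wilkie_isModelComplete_of_oneStep`,
  `Wilkie1996_realExp_modelsExistentiallyClosed_of_oneStep`,
  `Wilkie1996_expPolynomial_transfer_of_oneStep`, `wilkie_isOMinimal_of_oneStep` — the leaf,
  Wilkie's theorem and its corollaries from `hMC` and `h1`;
* `definableClosure_coe_elementarySubstructure_subset` (`Dcl(S) ⊆ S` for `S ≼ M`),
  `RealExpModel.oneStep_of_elementaryStep` — `h1` from its form `h1'` for **elementary pairs**
  `k' ≼ K | L_e` (the literal setting of Theorem 7.1.23 with `dim_k(K) = 1`, via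
  `Dcl_e(A) ≼ K | L_e` from the o-minimality of `K | L_e`), and the corollaries
  `RealExpModel.dclValRank_of_elementaryStep`,
  `Wilkie1996_expPolynomialPoints_bounded_of_elementaryStep`,
  `wilkie_isModelComplete_of_elementaryStep`, `Wilkie1996_expPolynomial_transfer_of_elementaryStep`.

What remains (`h1`) is den Besten's Theorem 7.1.23 in dimension `1` for `T_e`, whose printed
proof uses the `ℵ₀`-saturation argument of pp. 89–90, Theorem 7.1.22 (`valdim ≤ dim` for finitely
generated models, from the splitting Theorem 7.1.21 and Taylor expansion under smoothness `S₂`)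
and Theorem 7.2.1 (`T_e` is smooth: (V1) and the polynomial bounds (V2) of `Wilkie1996.lean`,
§ Status).  Nothing here is a named fact and no definition is introduced.

## References

* M. den Besten, *Wilkie's Theorem and the Uniform Real Schanuel Conjecture*, MSc thesis, Utrecht
  (2016): Definitions 7.1.14–7.1.18, Lemma 7.1.19 (p. 82), Theorem 7.1.23 (pp. 89–90),
  Corollary 6.2.4, Lemma 7.2.4. [DenBesten2016]
* A. J. Wilkie, *Model completeness results for expansions of the ordered field of real numbers by
  restricted Pfaffian functions and the exponential function*, J. Amer. Math. Soc. 9 (1996),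
  1051–1094: §10 (Theorems 10.3, 10.4), §11. [WilkieJAMS1996]
* D. Marker, *Model Theory: An Introduction*, Springer GTM 217 (2002), §1.4 (`dcl`,
  Exercise 1.4.10) and §2.3 (elementary substructures and embeddings). [Marker2002]
-/

noncomputable section

open FirstOrder FirstOrder.Language FirstOrder.Language.Structure

namespace Literature.ModelTheory.ExponentialFields

/-! ### The image of an elementary embedding is definably closed -/

/-- **The image of an elementary embedding is definably closed**: if `g : M ↪ₑ N` and `{b}` is
definable in `N` with parameters from `g(M)`, say by `φ(g(m̄), y)`, then `N ⊨ ∃ y φ(g(m̄), y)`,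
so `M ⊨ ∃ y φ(m̄, y)`, say `φ(m̄, m)`, whence `N ⊨ φ(g(m̄), g(m))` and `b = g(m)`.  In particular
an elementary substructure `k ≼ K` satisfies `Dcl(k) = k` (den Besten 2016, Remark 7.1.4 and
p. 89: the base `k = k₀` of the tower). [folklore] -/
theorem definableClosure_range_subset_of_elementaryEmbedding {L : Language} {M N : Type*}
    [L.Structure M] [L.Structure N] (g : M ↪ₑ[L] N) :
    definableClosure L (Set.range g) ⊆ Set.range g := by
  classical
  intro b hb
  obtain ⟨φ, hφ⟩ := Set.definable_iff_exists_formula_sum.1 (mem_definableClosure_iff.1 hb)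
  have hex : ∀ a : Set.range (g : M → N), ∃ m : M, g m = a := fun a => a.2
  choose c hc using hex
  have hgc : (g : M → N) ∘ c = fun a : Set.range (g : M → N) => (a : N) := funext hc
  have key : ∀ v : Fin 1 → N,
      φ.Realize (Sum.elim (fun a : Set.range (g : M → N) => (a : N)) v) ↔ v 0 = b := by
    intro v
    have h := (Set.ext_iff.1 hφ v).symm
    simpa using h
  -- `N ⊨ ∃ y φ(g(c̄), y)`
  have hN : (φ.iExs (Fin 1)).Realize ((g : M → N) ∘ c) := by
    rw [Formula.realize_iExs]
    refine ⟨fun _ => b, ?_⟩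
    rw [hgc]
    exact (key _).2 rfl
  -- hence `M ⊨ ∃ y φ(c̄, y)`, say at `i`
  rw [g.map_formula] at hN
  obtain ⟨i, hi⟩ := Formula.realize_iExs.1 hN
  -- and `N ⊨ φ(g(c̄), g(i))`, so `g(i) = b`
  have hN' : φ.Realize ((g : M → N) ∘ Sum.elim c i) := (g.map_formula φ (Sum.elim c i)).2 hi
  rw [Sum.comp_elim, hgc] at hN'
  exact ⟨i 0, (key _).1 hN'⟩

/-! ### Lemma 7.1.19 in multiplicative form: valuative rank is subadditive in towers -/

namespace ValRankTower

/-- **Combinatorial core of Lemma 7.1.19** (for predicates `P₁`, `P₂` on integer vectors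
indexed by a finite type `ι` with `|ι| > r₁ + r₂`): if every set of more than `r₂` coordinates
supports a non-zero vector satisfying `P₂`, and any `r₁ + 1` vectors satisfying `P₂` have a
`ℤ`-combination with coefficients not all zero satisfying `P₁`, then some non-zero vector
satisfies `P₁`.  (Take a maximal set `t` of coordinates supporting no non-zero `P₂`-vector;
`|t| ≤ r₂`; each of the `≥ r₁ + 1` coordinates `j ∉ t` supports, together with `t`, a
`P₂`-vector with non-zero `j`-th entry; combine `r₁ + 1` of them.) [cite: DenBesten2016, Lemma 7.1.19] -/
theorem exists_ne_zero_of_rank_conditions {ι : Type*} [Fintype ι] [DecidableEq ι]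
    (P₁ P₂ : (ι → ℤ) → Prop) {r₁ r₂ : ℕ} (hcard : r₁ + r₂ < Fintype.card ι)
    (h1 : ∀ p : Fin (r₁ + 1) → ι → ℤ, (∀ l, P₂ (p l)) →
      ∃ d : Fin (r₁ + 1) → ℤ, d ≠ 0 ∧ P₁ (∑ l, d l • p l))
    (h2 : ∀ t : Finset ι, r₂ < t.card → ∃ e, P₂ e ∧ e ≠ 0 ∧ ∀ i ∉ t, e i = 0) :
    ∃ E, P₁ E ∧ E ≠ 0 := by
  classical
  -- `t` is independent if it supports no non-zero `P₂`-vector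
  let Indep : Finset ι → Prop := fun t => ∀ e, P₂ e → (∀ i ∉ t, e i = 0) → e = 0
  have h0 : Indep ∅ := fun e _ he => funext fun i => he i (Finset.notMem_empty i)
  obtain ⟨t, ht, htmax⟩ := (Finset.univ.filter Indep).exists_max_image Finset.card
    ⟨∅, by simpa using h0⟩
  simp only [Finset.mem_filter, Finset.mem_univ, true_and] at ht htmax
  -- `|t| ≤ r₂`
  have htcard : t.card ≤ r₂ := by
    by_contra hlt
    obtain ⟨e, hP, hne, hsupp⟩ := h2 t (not_le.1 hlt)
    exact hne (ht e hP hsupp)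
  -- every `j ∉ t` supports, with `t`, a `P₂`-vector with non-zero `j`-th coordinate
  have hdep : ∀ j, j ∉ t → ∃ e, P₂ e ∧ (∀ i ∉ insert j t, e i = 0) ∧ e j ≠ 0 := by
    intro j hj
    have hnot : ¬ Indep (insert j t) := by
      intro hI
      have h := htmax _ hI
      rw [Finset.card_insert_of_notMem hj] at h
      omega
    simp only [Indep, not_forall, exists_prop] at hnot
    obtain ⟨e, hP, hsupp, hne⟩ := hnot
    refine ⟨e, hP, hsupp, fun hj0 => hne (ht e hP ?_)⟩
    intro i hi
    by_cases hij : i = j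
    · rw [hij]
      exact hj0
    · exact hsupp i (by simp [hij, hi])
  choose! vec hvecP hvecsupp hvecne using hdep
  -- `r₁ + 1` coordinates outside `t`
  have hle : Fintype.card (Fin (r₁ + 1)) ≤ tᶜ.card := by
    rw [Fintype.card_fin, Finset.card_compl]
    omega
  obtain ⟨σ, hσ⟩ := Function.Embedding.exists_of_card_le_finset hle
  have hσt : ∀ l, σ l ∉ t := fun l =>
    Finset.mem_compl.1 (Finset.mem_coe.1 (hσ ⟨l, rfl⟩))
  obtain ⟨d, hd, hP₁⟩ := h1 (fun l => vec (σ l)) fun l => hvecP _ (hσt l)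
  refine ⟨_, hP₁, ?_⟩
  obtain ⟨l₀, hl₀⟩ := Function.ne_iff.1 hd
  have hl₀' : d l₀ ≠ 0 := by simpa using hl₀
  intro hE
  have h := congrFun hE (σ l₀)
  rw [Finset.sum_apply, Finset.sum_eq_single l₀, Pi.smul_apply, smul_eq_mul, Pi.zero_apply,
    mul_eq_zero] at h
  · rcases h with h | h
    · exact hl₀' h
    · exact hvecne _ (hσt l₀) h
  · intro l _ hl
    rw [Pi.smul_apply, smul_eq_mul, hvecsupp _ (hσt l) (σ l₀) ?_, mul_zero]
    simp only [Finset.mem_insert, not_or]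
    exact ⟨fun h' => hl (σ.injective h').symm, hσt l₀⟩
  · simp

variable {K : Type*} [Field K]

/-- `x ^ (Σ_{l ∈ s} f l) = Π_{l ∈ s} x ^ (f l)` for `x ≠ 0` and integer exponents. [folklore] -/
theorem zpow_finset_sum {x : K} (hx : x ≠ 0) {κ : Type*} (s : Finset κ) (f : κ → ℤ) :
    x ^ (∑ l ∈ s, f l) = ∏ l ∈ s, x ^ f l := by
  classical
  induction s using Finset.induction_on with
  | empty => simp
  | @insert a s ha ih => rw [Finset.sum_insert ha, Finset.prod_insert ha, zpow_add₀ hx, ih]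

/-- Extending an exponent vector by zero along an injection does not change the monomial.
[folklore] -/
theorem prod_zpow_extend {ι κ : Type*} [Fintype ι] [Fintype κ] [DecidableEq ι]
    {σ : κ → ι} (hσ : Function.Injective σ) (x : ι → K) (e : κ → ℤ) :
    ∏ i, x i ^ Function.extend σ e 0 i = ∏ l, x (σ l) ^ e l := by
  classical
  rw [← Finset.prod_subset (Finset.subset_univ (Finset.univ.image σ))]
  · rw [Finset.prod_image fun a _ b _ hab => hσ hab]
    exact Finset.prod_congr rfl fun l _ => by rw [hσ.extend_apply]
  · intro i _ hi
    have hi' : ¬ ∃ l, σ l = i := by simpa [Finset.mem_image] using hi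
    rw [Function.extend_apply' _ _ _ hi', Pi.zero_apply, zpow_zero]

/-- An exponent vector extended by zero along an injection is non-zero if the original one is.
[folklore] -/
theorem extend_ne_zero {ι κ : Type*} {σ : κ → ι} (hσ : Function.Injective σ) {e : κ → ℤ}
    (he : e ≠ 0) : Function.extend σ e 0 ≠ 0 := by
  intro h0
  apply he
  funext l
  have h := congrFun h0 (σ l)
  rwa [hσ.extend_apply] at h

section H

variable {H : K → Prop}

/-- A predicate containing `1` and closed under `·` and `⁻¹` is closed under integer powers.
[folklore] -/
theorem pred_zpow (hH1 : H 1) (hHmul : ∀ {u v}, H u → H v → H (u * v))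
    (hHinv : ∀ {u}, H u → H u⁻¹) {u : K} (hu : H u) (n : ℤ) : H (u ^ n) := by
  have hpow : ∀ m : ℕ, H (u ^ m) := fun m => by
    induction m with
    | zero => simpa using hH1
    | succ m ih =>
      rw [pow_succ]
      exact hHmul ih hu
  cases n with
  | ofNat m =>
    rw [Int.ofNat_eq_natCast, zpow_natCast]
    exact hpow m
  | negSucc m =>
    rw [zpow_negSucc]
    exact hHinv (hpow _)

/-- … and under finite products. [folklore] -/
theorem pred_prod (hH1 : H 1) (hHmul : ∀ {u v}, H u → H v → H (u * v)) {κ : Type*}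
    (s : Finset κ) {g : κ → K} (hg : ∀ l ∈ s, H (g l)) : H (∏ l ∈ s, g l) :=
  Finset.prod_induction g H (fun _ _ ha hb => hHmul ha hb) hH1 hg

/-- **Lemma 7.1.19 (`valdim_{k₀}(K) = valdim_{k₀}(k₁) + valdim_{k₁}(K)`), the inequality `≤`, in
multiplicative form.**  Let `H` be a subgroup of `K^×` given as a predicate (in the application:
`f(k)^×` times the units of `Fin(K)`, i.e. "valuation in `ν[k^×]`") and `A` any predicate (the
intermediate field).  If any `r₁ + 1` non-zero elements of `A` admit exponents `d ≠ 0` with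
`Π aₗ^{dₗ} ∈ H` (rank of `A` over `H` at most `r₁`), and any `r₂ + 1` of the non-zero elements
`x₀, …, x_{r₁+r₂}` admit exponents `e ≠ 0` and a non-zero `a ∈ A` with `a · Π x_{σ(l)}^{eₗ} ∈ H`
(rank over `A^× · H` at most `r₂`), then `Π xᵢ^{Eᵢ} ∈ H` for some `E ≠ 0` (rank over `H` at
most `r₁ + r₂`).  Proof: `exists_ne_zero_of_rank_conditions` for `P₁ = {E | Π x^E ∈ H}`,
`P₂ = {E | ∃ a ∈ A^×, a Π x^E ∈ H}`; a combination `Σ dₗ p⁽ˡ⁾` of `P₂`-vectors with witnesses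
`aₗ` lies in `P₁` as soon as `Π aₗ^{dₗ} ∈ H`, because
`Π x^{Σ dₗ p⁽ˡ⁾} = Πₗ (aₗ Π x^{p⁽ˡ⁾})^{dₗ} · (Πₗ aₗ^{dₗ})⁻¹`. [cite: DenBesten2016, Lemma 7.1.19] -/
theorem exists_zpow_rel_of_tower {A : K → Prop}
    (hH1 : H 1) (hHmul : ∀ {u v}, H u → H v → H (u * v)) (hHinv : ∀ {u}, H u → H u⁻¹)
    {r₁ r₂ : ℕ}
    (hA : ∀ a : Fin (r₁ + 1) → K, (∀ l, A (a l)) → (∀ l, a l ≠ 0) →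
      ∃ d : Fin (r₁ + 1) → ℤ, d ≠ 0 ∧ H (∏ l, a l ^ d l))
    (x : Fin (r₁ + r₂ + 1) → K) (hx : ∀ i, x i ≠ 0)
    (hx2 : ∀ σ : Fin (r₂ + 1) → Fin (r₁ + r₂ + 1), Function.Injective σ →
      ∃ e : Fin (r₂ + 1) → ℤ, e ≠ 0 ∧ ∃ a, A a ∧ a ≠ 0 ∧ H (a * ∏ l, x (σ l) ^ e l)) :
    ∃ e : Fin (r₁ + r₂ + 1) → ℤ, e ≠ 0 ∧ H (∏ i, x i ^ e i) := by
  classical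
  -- (1) combinations of `P₂`-vectors
  have h1 : ∀ p : Fin (r₁ + 1) → Fin (r₁ + r₂ + 1) → ℤ,
      (∀ l, ∃ a, A a ∧ a ≠ 0 ∧ H (a * ∏ i, x i ^ p l i)) →
        ∃ d : Fin (r₁ + 1) → ℤ, d ≠ 0 ∧ H (∏ i, x i ^ (∑ l, d l • p l) i) := by
    intro p hp
    choose a haA ha0 haH using hp
    obtain ⟨d, hd, hdH⟩ := hA a haA ha0
    refine ⟨d, hd, ?_⟩
    have hL : ∏ i, x i ^ (∑ l, d l • p l) i = ∏ l, (∏ i, x i ^ p l i) ^ d l := by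
      calc ∏ i, x i ^ (∑ l, d l • p l) i = ∏ i, ∏ l, (x i ^ p l i) ^ d l := by
            refine Finset.prod_congr rfl fun i _ => ?_
            rw [Finset.sum_apply, zpow_finset_sum (hx i)]
            refine Finset.prod_congr rfl fun l _ => ?_
            rw [Pi.smul_apply, smul_eq_mul, mul_comm, zpow_mul]
        _ = ∏ l, ∏ i, (x i ^ p l i) ^ d l := Finset.prod_comm
        _ = ∏ l, (∏ i, x i ^ p l i) ^ d l :=
            Finset.prod_congr rfl fun l _ => Finset.prod_zpow _ _ _
    have hA0 : (∏ l, a l ^ d l) ≠ 0 :=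
      Finset.prod_ne_zero_iff.2 fun l _ => zpow_ne_zero _ (ha0 l)
    have hR : (∏ l, (a l * ∏ i, x i ^ p l i) ^ d l) * (∏ l, a l ^ d l)⁻¹ =
        ∏ l, (∏ i, x i ^ p l i) ^ d l := by
      simp_rw [mul_zpow]
      rw [Finset.prod_mul_distrib, mul_comm (∏ l, a l ^ d l), mul_inv_cancel_right₀ hA0]
    rw [hL, ← hR]
    exact hHmul (pred_prod hH1 hHmul _ fun l _ => pred_zpow hH1 hHmul hHinv (haH l) (d l))
      (hHinv hdH)
  -- (2) every `r₂ + 1` coordinates support a non-zero `P₂`-vector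
  have h2 : ∀ t : Finset (Fin (r₁ + r₂ + 1)), r₂ < t.card →
      ∃ e : Fin (r₁ + r₂ + 1) → ℤ,
        (∃ a, A a ∧ a ≠ 0 ∧ H (a * ∏ i, x i ^ e i)) ∧ e ≠ 0 ∧ ∀ i ∉ t, e i = 0 := by
    intro t ht
    have hle : Fintype.card (Fin (r₂ + 1)) ≤ t.card := by
      rw [Fintype.card_fin]
      omega
    obtain ⟨σ, hσ⟩ := Function.Embedding.exists_of_card_le_finset hle
    obtain ⟨e, he, a, haA, ha0, haH⟩ := hx2 σ σ.injective
    refine ⟨Function.extend σ e 0, ⟨a, haA, ha0, ?_⟩, extend_ne_zero σ.injective he, ?_⟩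
    · rwa [prod_zpow_extend σ.injective]
    · intro i hi
      have hi' : ¬ ∃ l, σ l = i := by
        rintro ⟨l, rfl⟩
        exact hi (Finset.mem_coe.1 (hσ ⟨l, rfl⟩))
      rw [Function.extend_apply' _ _ _ hi', Pi.zero_apply]
  obtain ⟨E, hE, hE0⟩ := exists_ne_zero_of_rank_conditions
    (fun e : Fin (r₁ + r₂ + 1) → ℤ => H (∏ i, x i ^ e i))
    (fun e : Fin (r₁ + r₂ + 1) → ℤ => ∃ a, A a ∧ a ≠ 0 ∧ H (a * ∏ i, x i ^ e i))
    (r₁ := r₁) (r₂ := r₂) (by rw [Fintype.card_fin]; omega) h1 h2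
  exact ⟨E, hE0, hE⟩

end H

end ValRankTower

/-! ### `hV` from the First Main Theorem and the one-step valuation inequality -/

namespace RealExpModel

variable {k K : Language.Theory.ModelType.{0, 0, 0} realExpTheory}

/-- `1` is a valuation unit. [folklore] -/
theorem isVUnit_one : IsVUnit (1 : K) :=
  ⟨1, by simp, by simp⟩

open ValRankTower in
/-- **The valuative-rank bound `hV` of `Wilkie1996DclValRank.lean` from the First Main Theorem
and the one-step valuation inequality** (den Besten 2016, Theorem 7.1.23, the reduction "it is
enough to prove the inequality … just for the case `dim_k(K) = 1`" by Lemmas 7.1.13 and 7.1.19,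
here an induction on the finite set `B`): the base `B = ∅` is `Dcl_e(f(k)) = f(k)`
(`f(k) ≼ K | L_e` by the First Main Theorem, `RealExpModel.eElementaryEmbeddingOfRexp`;
Corollary 6.2.4), and the step `B ↦ B ∪ {b}` is Lemma 7.1.19 (`exists_zpow_rel_of_tower` with
`H = f(k)^× · Fin(K)^×`, `A = Dcl_e(f(k) ∪ B)`, `r₂ = 1`) fed with the hypothesis `h1` for
`A = f(k) ∪ B`. [cite: DenBesten2016, Theorem 7.1.23 and Lemma 7.1.19] -/
theorem dclValRank_of_oneStep (hMC : rexpTheory.IsModelComplete)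
    (h1 : ∀ (K : Language.Theory.ModelType.{0, 0, 0} realExpTheory) (A : Set K) (b : K)
      (x : Fin 2 → K), (∀ j, x j ∈ definableClosure Language.orderedERing (insert b A)) →
      (∀ j, x j ≠ 0) → ∃ e : Fin 2 → ℤ, e ≠ 0 ∧
        ∃ a ∈ definableClosure Language.orderedERing A, a ≠ 0 ∧ IsVUnit (a * ∏ j, x j ^ e j))
    (k K : Language.Theory.ModelType.{0, 0, 0} realExpTheory)
    (f : k ↪[Language.orderedExpRing] K) (B : Finset K) (x : Fin (B.card + 1) → K)
    (hx : ∀ j, x j ∈ definableClosure Language.orderedERing (Set.range f ∪ ↑B))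
    (hx0 : ∀ j, x j ≠ 0) :
    ∃ e : Fin (B.card + 1) → ℤ, e ≠ 0 ∧ ∃ c : k, c ≠ 0 ∧ IsVUnit (f c * ∏ j, x j ^ e j) := by
  classical
  -- `H y :↔ ∃ c ∈ k^×, f(c) y ∈ Fin(K)^×` is a subgroup of `K^×`
  have hH1 : ∃ c : k, c ≠ 0 ∧ IsVUnit (f c * 1) :=
    ⟨1, one_ne_zero, by rw [RealExpModel.map_one, one_mul]; exact isVUnit_one⟩
  have hHmul : ∀ {u v : K}, (∃ c : k, c ≠ 0 ∧ IsVUnit (f c * u)) →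
      (∃ c : k, c ≠ 0 ∧ IsVUnit (f c * v)) → ∃ c : k, c ≠ 0 ∧ IsVUnit (f c * (u * v)) := by
    rintro u v ⟨c, hc, hu⟩ ⟨c', hc', hv⟩
    refine ⟨c * c', mul_ne_zero hc hc', ?_⟩
    rw [RealExpModel.map_mul, mul_mul_mul_comm]
    exact hu.mul hv
  have hHinv : ∀ {u : K}, (∃ c : k, c ≠ 0 ∧ IsVUnit (f c * u)) →
      ∃ c : k, c ≠ 0 ∧ IsVUnit (f c * u⁻¹) := by
    rintro u ⟨c, hc, hu⟩
    refine ⟨c⁻¹, inv_ne_zero hc, ?_⟩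
    rw [RealExpModel.map_inv, ← mul_inv]
    exact hu.inv
  -- the base: `Dcl_e(f(k)) ⊆ f(k)`
  have hrange : Set.range (eElementaryEmbeddingOfRexp hMC f) = Set.range (f : k → K) := by
    ext y
    simp
  have hbase : definableClosure Language.orderedERing (Set.range (f : k → K)) ⊆
      Set.range (f : k → K) := by
    have h := definableClosure_range_subset_of_elementaryEmbedding
      (eElementaryEmbeddingOfRexp hMC f)
    rwa [hrange] at h
  -- induction on `B`, the cardinality decoupled from `B`
  suffices key : ∀ (B : Finset K) (m : ℕ), B.card = m → ∀ x : Fin (m + 1) → K,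
      (∀ j, x j ∈ definableClosure Language.orderedERing (Set.range f ∪ ↑B)) →
      (∀ j, x j ≠ 0) →
        ∃ e : Fin (m + 1) → ℤ, e ≠ 0 ∧ ∃ c : k, c ≠ 0 ∧ IsVUnit (f c * ∏ j, x j ^ e j) from
    key B B.card rfl x hx hx0
  intro B
  induction B using Finset.induction_on with
  | empty =>
    intro m hm x hx hx0
    rw [Finset.card_empty] at hm
    subst hm
    have hx' : x 0 ∈ Set.range (f : k → K) := by
      refine hbase ?_
      have h := hx 0
      rwa [Finset.coe_empty, Set.union_empty] at h
    obtain ⟨c₀, hc₀⟩ := hx'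
    have hc₀0 : c₀ ≠ 0 := by
      rintro rfl
      exact hx0 0 (by rw [← hc₀, RealExpModel.map_zero])
    refine ⟨fun _ => 1, ?_, c₀⁻¹, inv_ne_zero hc₀0, ?_⟩
    · intro h
      have h' := congrFun h 0
      simp at h'
    · rw [Fin.prod_univ_one, zpow_one, ← hc₀, ← RealExpModel.map_mul, inv_mul_cancel₀ hc₀0,
        RealExpModel.map_one]
      exact isVUnit_one
  | @insert b B hb ih =>
    intro m hm x hx hx0
    rw [Finset.card_insert_of_notMem hb] at hm
    subst hm
    refine exists_zpow_rel_of_tower (H := fun y => ∃ c : k, c ≠ 0 ∧ IsVUnit (f c * y))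
      (A := fun y => y ∈ definableClosure Language.orderedERing (Set.range f ∪ ↑B))
      hH1 hHmul hHinv (r₁ := B.card) (r₂ := 1) (fun a haA ha0 => ih B.card rfl a haA ha0)
      x hx0 ?_
    intro σ hσ
    have hmem : ∀ l, x (σ l) ∈
        definableClosure Language.orderedERing (insert b (Set.range f ∪ ↑B)) := fun l => by
      have h := hx (σ l)
      rwa [Finset.coe_insert, Set.union_insert] at h
    obtain ⟨e, he, a, haA, ha0, hu⟩ :=
      h1 K (Set.range f ∪ ↑B) b (fun l => x (σ l)) hmem fun l => hx0 _
    refine ⟨e, he, a, haA, ha0, 1, one_ne_zero, ?_⟩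
    rw [RealExpModel.map_one, one_mul]
    exact hu

end RealExpModel

/-! ### Wilkie's theorem from the First Main Theorem and the one-step valuation inequality -/

/-- **The boundedness leaf (`Wilkie1996_expPolynomialPoints_bounded`, Wilkie 1996, §9) from the
First Main Theorem for `exp↾[0,1]` and the one-step valuation inequality for `T_e`** — through
`RealExpModel.dclValRank_of_oneStep` and `Wilkie1996_expPolynomialPoints_bounded_of_dclValRank`.
[cite: WilkieJAMS1996, §§9–11] [cite: DenBesten2016, Theorem 7.1.23 and Lemma 7.2.4] -/
theorem Wilkie1996_expPolynomialPoints_bounded_of_oneStep (hMC : rexpTheory.IsModelComplete)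
    (h1 : ∀ (K : Language.Theory.ModelType.{0, 0, 0} realExpTheory) (A : Set K) (b : K)
      (x : Fin 2 → K), (∀ j, x j ∈ definableClosure Language.orderedERing (insert b A)) →
      (∀ j, x j ≠ 0) → ∃ e : Fin 2 → ℤ, e ≠ 0 ∧
        ∃ a ∈ definableClosure Language.orderedERing A, a ≠ 0 ∧
          RealExpModel.IsVUnit (a * ∏ j, x j ^ e j)) :
    Wilkie1996_expPolynomialPoints_bounded :=
  Wilkie1996_expPolynomialPoints_bounded_of_dclValRank (RealExpModel.dclValRank_of_oneStep hMC h1)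

/-- **Wilkie's theorem (`wilkie_isModelComplete`) from the First Main Theorem for `exp↾[0,1]`
and the one-step valuation inequality for `T_e`.** [cite: WilkieJAMS1996, Second Main Theorem and §§9–11] -/
theorem wilkie_isModelComplete_of_oneStep (hMC : rexpTheory.IsModelComplete)
    (h1 : ∀ (K : Language.Theory.ModelType.{0, 0, 0} realExpTheory) (A : Set K) (b : K)
      (x : Fin 2 → K), (∀ j, x j ∈ definableClosure Language.orderedERing (insert b A)) →
      (∀ j, x j ≠ 0) → ∃ e : Fin 2 → ℤ, e ≠ 0 ∧
        ∃ a ∈ definableClosure Language.orderedERing A, a ≠ 0 ∧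
          RealExpModel.IsVUnit (a * ∏ j, x j ^ e j)) :
    wilkie_isModelComplete :=
  wilkie_isModelComplete_of_expPolynomialPoints_bounded
    (Wilkie1996_expPolynomialPoints_bounded_of_oneStep hMC h1)

/-- **The models of `T_exp` are existentially closed in one another
(`Wilkie1996_realExp_modelsExistentiallyClosed`) from the First Main Theorem for `exp↾[0,1]` and
the one-step valuation inequality for `T_e`.** [cite: WilkieJAMS1996, §9 (p. 1083) and §§10–11] -/
theorem Wilkie1996_realExp_modelsExistentiallyClosed_of_oneStep (hMC : rexpTheory.IsModelComplete)
    (h1 : ∀ (K : Language.Theory.ModelType.{0, 0, 0} realExpTheory) (A : Set K) (b : K)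
      (x : Fin 2 → K), (∀ j, x j ∈ definableClosure Language.orderedERing (insert b A)) →
      (∀ j, x j ≠ 0) → ∃ e : Fin 2 → ℤ, e ≠ 0 ∧
        ∃ a ∈ definableClosure Language.orderedERing A, a ≠ 0 ∧
          RealExpModel.IsVUnit (a * ∏ j, x j ^ e j)) :
    Wilkie1996_realExp_modelsExistentiallyClosed :=
  Wilkie1996_realExp_modelsExistentiallyClosed_of_expPolynomialPoints_bounded
    (Wilkie1996_expPolynomialPoints_bounded_of_oneStep hMC h1)

/-- **The transfer of solvability of `p(x̄, e^{x̄}) = 0` between models `k ⊆ K` of `T_exp`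
(`Wilkie1996_expPolynomial_transfer`, Wilkie's "I only had to show …") from the First Main
Theorem for `exp↾[0,1]` and the one-step valuation inequality for `T_e`.**
[cite: WilkieJAMS1996, Second Main Theorem and §§9–11] -/
theorem Wilkie1996_expPolynomial_transfer_of_oneStep (hMC : rexpTheory.IsModelComplete)
    (h1 : ∀ (K : Language.Theory.ModelType.{0, 0, 0} realExpTheory) (A : Set K) (b : K)
      (x : Fin 2 → K), (∀ j, x j ∈ definableClosure Language.orderedERing (insert b A)) →
      (∀ j, x j ≠ 0) → ∃ e : Fin 2 → ℤ, e ≠ 0 ∧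
        ∃ a ∈ definableClosure Language.orderedERing A, a ≠ 0 ∧
          RealExpModel.IsVUnit (a * ∏ j, x j ^ e j)) :
    Wilkie1996_expPolynomial_transfer :=
  Wilkie1996_expPolynomial_transfer_of_expPolynomialPoints_bounded
    (Wilkie1996_expPolynomialPoints_bounded_of_oneStep hMC h1)

/-- **O-minimality of `ℝ_exp` (`wilkie_isOMinimal`) from the First Main Theorem for `exp↾[0,1]`
and the one-step valuation inequality for `T_e`.** [cite: WilkieJAMS1996, Second Main Theorem and §§9–11] -/
theorem wilkie_isOMinimal_of_oneStep (hMC : rexpTheory.IsModelComplete)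
    (h1 : ∀ (K : Language.Theory.ModelType.{0, 0, 0} realExpTheory) (A : Set K) (b : K)
      (x : Fin 2 → K), (∀ j, x j ∈ definableClosure Language.orderedERing (insert b A)) →
      (∀ j, x j ≠ 0) → ∃ e : Fin 2 → ℤ, e ≠ 0 ∧
        ∃ a ∈ definableClosure Language.orderedERing A, a ≠ 0 ∧
          RealExpModel.IsVUnit (a * ∏ j, x j ^ e j)) :
    wilkie_isOMinimal :=
  wilkie_isOMinimal_of_expPolynomialPoints_bounded
    (Wilkie1996_expPolynomialPoints_bounded_of_oneStep hMC h1)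

/-! ### The one-step inequality in den Besten's setting: elementary pairs `k' ≼ K | L_e` -/

/-- **An elementary substructure is definably closed**: `Dcl(S) ⊆ S` for `S ≼ M`
(`definableClosure_range_subset_of_elementaryEmbedding` for `S.subtype`; den Besten 2016,
Remark 7.1.4). [folklore] -/
theorem definableClosure_coe_elementarySubstructure_subset {L : Language} {M : Type*}
    [L.Structure M] (S : L.ElementarySubstructure M) :
    definableClosure L (S : Set M) ⊆ S := by
  have hr : Set.range (S.subtype : S → M) = (S : Set M) := by
    ext x
    simp
  have h := definableClosure_range_subset_of_elementaryEmbedding S.subtype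
  rwa [hr] at h

namespace RealExpModel

/-- **The one-step valuation inequality `h1` from its form for elementary pairs** — the exact
setting of den Besten's Theorem 7.1.23 with `dim_k(K) = 1` ("`k, K ⊨ T_O` with `k ⊆ K` … `K` is
generated (over `k`) by a single element, say `a ∈ K`"): it suffices to know, for every
`K ⊨ T_exp`, every **elementary** `L_e`-substructure `k' ≼ K | L_e` and every `b ∈ K`, that any
two non-zero elements of `Dcl_e(k' ∪ {b})` have a relation modulo `k'^× · Fin(K)^×`; for an
arbitrary `A ⊆ K` one takes `k' = Dcl_e(A)`, an elementary substructure by the o-minimality of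
`K | L_e` (First Main Theorem, `RealExpModel.isOMinimal_orderedERing_of_rexp_isModelComplete`;
`isElementary_definableClosureSubstructure_of_orderedField`, den Besten Remark 7.1.4), and
`Dcl_e(A ∪ {b}) ⊆ Dcl_e(k' ∪ {b})`. [cite: DenBesten2016, Theorem 7.1.23 and Remark 7.1.4] -/
theorem oneStep_of_elementaryStep (hMC : rexpTheory.IsModelComplete)
    (h1' : ∀ (K : Language.Theory.ModelType.{0, 0, 0} realExpTheory)
      (S : Language.orderedERing.ElementarySubstructure K) (b : K) (x : Fin 2 → K),
      (∀ j, x j ∈ definableClosure Language.orderedERing (insert b (S : Set K))) →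
      (∀ j, x j ≠ 0) → ∃ e : Fin 2 → ℤ, e ≠ 0 ∧ ∃ a ∈ S, a ≠ 0 ∧ IsVUnit (a * ∏ j, x j ^ e j))
    (K : Language.Theory.ModelType.{0, 0, 0} realExpTheory) (A : Set K) (b : K) (x : Fin 2 → K)
    (hx : ∀ j, x j ∈ definableClosure Language.orderedERing (insert b A)) (hx0 : ∀ j, x j ≠ 0) :
    ∃ e : Fin 2 → ℤ, e ≠ 0 ∧ ∃ a ∈ definableClosure Language.orderedERing A, a ≠ 0 ∧
      IsVUnit (a * ∏ j, x j ^ e j) := by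
  let φe : Language.orderedRing →ᴸ Language.orderedERing := LHom.sumInl
  let S : Language.orderedERing.ElementarySubstructure K :=
    ⟨definableClosureSubstructure Language.orderedERing A,
      isElementary_definableClosureSubstructure_of_orderedField φe
        (isOMinimal_orderedERing_of_rexp_isModelComplete hMC K) A⟩
  have hS : (S : Set K) = definableClosure Language.orderedERing A := rfl
  have hx' : ∀ j, x j ∈ definableClosure Language.orderedERing (insert b (S : Set K)) :=
    fun j => definableClosure_mono
      (Set.insert_subset_insert (hS ▸ subset_definableClosure A)) (hx j)
  obtain ⟨e, he, a, haS, ha0, hu⟩ := h1' K S b x hx' hx0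
  exact ⟨e, he, a, haS, ha0, hu⟩

/-- **`hV` from the First Main Theorem and the one-step valuation inequality for elementary
pairs** (`dclValRank_of_oneStep` with `oneStep_of_elementaryStep`). [cite: DenBesten2016, Theorem 7.1.23 and Lemma 7.1.19] -/
theorem dclValRank_of_elementaryStep (hMC : rexpTheory.IsModelComplete)
    (h1' : ∀ (K : Language.Theory.ModelType.{0, 0, 0} realExpTheory)
      (S : Language.orderedERing.ElementarySubstructure K) (b : K) (x : Fin 2 → K),
      (∀ j, x j ∈ definableClosure Language.orderedERing (insert b (S : Set K))) →
      (∀ j, x j ≠ 0) → ∃ e : Fin 2 → ℤ, e ≠ 0 ∧ ∃ a ∈ S, a ≠ 0 ∧ IsVUnit (a * ∏ j, x j ^ e j))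
    (k K : Language.Theory.ModelType.{0, 0, 0} realExpTheory)
    (f : k ↪[Language.orderedExpRing] K) (B : Finset K) (x : Fin (B.card + 1) → K)
    (hx : ∀ j, x j ∈ definableClosure Language.orderedERing (Set.range f ∪ ↑B))
    (hx0 : ∀ j, x j ≠ 0) :
    ∃ e : Fin (B.card + 1) → ℤ, e ≠ 0 ∧ ∃ c : k, c ≠ 0 ∧ IsVUnit (f c * ∏ j, x j ^ e j) :=
  dclValRank_of_oneStep hMC (oneStep_of_elementaryStep hMC h1') k K f B x hx hx0

end RealExpModel

/-- **The boundedness leaf from the First Main Theorem and the one-step valuation inequality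
for elementary pairs `k' ≼ K | L_e`** (den Besten, Theorem 7.1.23 with `dim = 1`).
[cite: WilkieJAMS1996, §§9–11] [cite: DenBesten2016, Theorem 7.1.23 and Lemma 7.2.4] -/
theorem Wilkie1996_expPolynomialPoints_bounded_of_elementaryStep
    (hMC : rexpTheory.IsModelComplete)
    (h1' : ∀ (K : Language.Theory.ModelType.{0, 0, 0} realExpTheory)
      (S : Language.orderedERing.ElementarySubstructure K) (b : K) (x : Fin 2 → K),
      (∀ j, x j ∈ definableClosure Language.orderedERing (insert b (S : Set K))) →
      (∀ j, x j ≠ 0) → ∃ e : Fin 2 → ℤ, e ≠ 0 ∧ ∃ a ∈ S, a ≠ 0 ∧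
        RealExpModel.IsVUnit (a * ∏ j, x j ^ e j)) :
    Wilkie1996_expPolynomialPoints_bounded :=
  Wilkie1996_expPolynomialPoints_bounded_of_dclValRank
    (RealExpModel.dclValRank_of_elementaryStep hMC h1')

/-- **Wilkie's theorem from the First Main Theorem and the one-step valuation inequality for
elementary pairs.** [cite: WilkieJAMS1996, Second Main Theorem and §§9–11] -/
theorem wilkie_isModelComplete_of_elementaryStep (hMC : rexpTheory.IsModelComplete)
    (h1' : ∀ (K : Language.Theory.ModelType.{0, 0, 0} realExpTheory)
      (S : Language.orderedERing.ElementarySubstructure K) (b : K) (x : Fin 2 → K),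
      (∀ j, x j ∈ definableClosure Language.orderedERing (insert b (S : Set K))) →
      (∀ j, x j ≠ 0) → ∃ e : Fin 2 → ℤ, e ≠ 0 ∧ ∃ a ∈ S, a ≠ 0 ∧
        RealExpModel.IsVUnit (a * ∏ j, x j ^ e j)) :
    wilkie_isModelComplete :=
  wilkie_isModelComplete_of_expPolynomialPoints_bounded
    (Wilkie1996_expPolynomialPoints_bounded_of_elementaryStep hMC h1')

/-- **`Wilkie1996_expPolynomial_transfer` from the First Main Theorem and the one-step
valuation inequality for elementary pairs.** [cite: WilkieJAMS1996, Second Main Theorem and §§9–11] -/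
theorem Wilkie1996_expPolynomial_transfer_of_elementaryStep (hMC : rexpTheory.IsModelComplete)
    (h1' : ∀ (K : Language.Theory.ModelType.{0, 0, 0} realExpTheory)
      (S : Language.orderedERing.ElementarySubstructure K) (b : K) (x : Fin 2 → K),
      (∀ j, x j ∈ definableClosure Language.orderedERing (insert b (S : Set K))) →
      (∀ j, x j ≠ 0) → ∃ e : Fin 2 → ℤ, e ≠ 0 ∧ ∃ a ∈ S, a ≠ 0 ∧
        RealExpModel.IsVUnit (a * ∏ j, x j ^ e j)) :
    Wilkie1996_expPolynomial_transfer :=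
  Wilkie1996_expPolynomial_transfer_of_expPolynomialPoints_bounded
    (Wilkie1996_expPolynomialPoints_bounded_of_elementaryStep hMC h1')

end Literature.ModelTheory.ExponentialFields
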